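import Mathlib
import Summits.ValiantsHypothesis.ValiantsHypothesis.Theorems.NewtonUnitEquationsDissociatedUniformTotalsLawHeavyPairs
import HarnessLib

/-!
# Crux `NewtonUnitEquations.DissociatedUniform` (stmt-ValiantsHypothesis-5905), `n = 3` totals law of model (Q**):
# the combinatorial core of the sub-cubic bound is SHARP at exponent `5/2` (abstract interval systems attain `Σ min = |G|^{5/2}`)

`…TotalsLawHeavyPairs.sum_min_topDeg_le` bounds, for ANY two interval systems `TQ, TR` over a finite type `G` (`q = |G|`) and any
times `b`, `Σ_{(x,y)} min (deg_Q^{b} y) (deg_R^{b} x) ≤ 2Kq² + 16q³/K = O(q^{5/2})`; this is the only lossy step of the general bound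
`T(a,b,c) = O(q^{5/2})` (`…TotalsLawSubCubic`).  THIS FILE: the abstract statement cannot be improved — for `G = ZMod k × ZMod k`
(`q = k²`) there are interval systems and times with `Σ min = k⁵ = q^{5/2}` exactly (`sum_min_topDeg_sharp`).  Construction (memo
NOTES-t1g14 §3): `q` phases `i = k₁k + k₂`; in phase `i` the `R`-top letter of the fibre `u` is `(k₁, u₂)` and the `Q`-top letter of the
fibre `t` is `(k₂, t₂ + k₁)`; every letter that is on top has degree `k`, every (fibre, letter) incidence is a single interval of phases, and
the pair `((x₁,x₂),(y₁,y₂))` is doubly `k`-heavy in phase `x₁k + y₁`.  CONSEQUENCE FOR THE PROGRAMME: any improvement of the exponent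
`5/2` must use geometric input coupling the realised systems (e.g. the located `UpCrossingLaw` of `…TotalsLawUpCrossing`, which this
abstract family violates: its `Q`-letters re-burst `k` times); the interval-system axioms alone are exhausted.  Nothing here bears on
`TotalsLawThree` (OPEN) or VP ≠ VNP.
[folklore]
-/

set_option linter.dupNamespace false -- `ValiantsHypothesis.ValiantsHypothesis` (summit = problem) in every name

open Finset

namespace Summit.ValiantsHypothesis.ValiantsHypothesis.Theorems.NewtonUnitEquationsDissociatedUniform

namespace TotalsLaw

namespace SharpFamily5

variable (k : ℕ) [NeZero k]

/-- The `R`-system of the sharp family: in phase `i` the fibre `u` is topped by `(⌊i/k⌋, u₂)`. -/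
def TRk (i : ℕ) (u : ZMod k × ZMod k) : ZMod k × ZMod k := (((i / k : ℕ) : ZMod k), u.2)

/-- The `Q`-system of the sharp family: in phase `i` the fibre `t` is topped by `(i mod k, t₂ + ⌊i/k⌋)`. -/
def TQk (i : ℕ) (t : ZMod k × ZMod k) : ZMod k × ZMod k := (((i : ℕ) : ZMod k), t.2 + ((i / k : ℕ) : ZMod k))

/-- The doubly heavy phase of the pair `(x, y)`: `x₁·k + y₁`. -/
def bk (p : (ZMod k × ZMod k) × (ZMod k × ZMod k)) : ℕ := p.1.1.val * k + p.2.1.val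

variable {k}

omit [NeZero k] in
/-- Casts of two naturals `< k` agree in `ZMod k` only if the naturals agree. [folklore] -/
theorem eq_of_cast_eq {i j : ℕ} (hi : i < k) (hj : j < k) (h : ((i : ℕ) : ZMod k) = ((j : ℕ) : ZMod k)) : i = j := by
  have h1 := congrArg ZMod.val h
  rwa [ZMod.val_natCast, ZMod.val_natCast, Nat.mod_eq_of_lt hi, Nat.mod_eq_of_lt hj] at h1

/-- Quotients of phases `≤ k² - 1` are `< k`. [folklore] -/
theorem div_lt {i : ℕ} (hi : i ≤ k * k - 1) : i / k < k := by
  have hk : 0 < k := Nat.pos_of_ne_zero (NeZero.ne k)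
  have : i < k * k := by
    have : 0 < k * k := Nat.mul_pos hk hk
    omega
  exact Nat.div_lt_of_lt_mul this

/-- `TRk` is an interval system up to `k² - 1`. [folklore] -/
theorem isIntervalSys_TRk : IsIntervalSys (k * k - 1) (TRk k) := by
  intro u ℓ i j m hij hjm hm hi hm'
  simp only [TRk] at hi hm' ⊢
  rw [← hi] at hm'
  have h1 : m / k = i / k :=
    eq_of_cast_eq (div_lt hm) (div_lt (le_trans (le_trans hij hjm) hm)) (congrArg Prod.fst hm')
  have h2 : j / k = i / k := le_antisymm (h1 ▸ Nat.div_le_div_right hjm) (Nat.div_le_div_right hij)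
  rw [← hi, h2]

/-- `TQk` is an interval system up to `k² - 1` (a `Q`-fibre never returns to a letter). [folklore] -/
theorem isIntervalSys_TQk : IsIntervalSys (k * k - 1) (TQk k) := by
  intro t ℓ i j m hij hjm hm hi hm'
  simp only [TQk] at hi hm' ⊢
  rw [← hi] at hm'
  have hik : i ≤ k * k - 1 := le_trans (le_trans hij hjm) hm
  have h1 : m / k = i / k := by
    have := congrArg Prod.snd hm'
    simp only at this
    exact eq_of_cast_eq (div_lt hm) (div_lt hik) (add_left_cancel this)
  have hk : 0 < k := Nat.pos_of_ne_zero (NeZero.ne k)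
  have h2 : m % k = i % k := eq_of_cast_eq (Nat.mod_lt _ hk) (Nat.mod_lt _ hk) (by
    have := congrArg Prod.fst hm'
    simp only at this
    rw [← ZMod.natCast_mod m k, ← ZMod.natCast_mod i k] at this
    exact this)
  have h3 : m = i := by rw [← Nat.div_add_mod m k, ← Nat.div_add_mod i k, h1, h2]
  have h4 : j = i := le_antisymm (h3 ▸ hjm) hij
  rw [h4, hi]

/-- The number of fibres with prescribed second coordinate is `k`. [folklore] -/
theorem card_filter_snd_eq (c : ZMod k) : (univ.filter fun u : ZMod k × ZMod k => u.2 = c).card = k := by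
  classical
  have : (univ.filter fun u : ZMod k × ZMod k => u.2 = c) = (univ : Finset (ZMod k)).map ⟨fun v => (v, c), fun v w h => by
      simpa using congrArg Prod.fst h⟩ := by
    ext ⟨u1, u2⟩
    simp only [mem_filter, mem_univ, true_and, mem_map, Function.Embedding.coeFn_mk, Prod.mk.injEq]
    constructor
    · intro h; exact ⟨u1, rfl, h.symm⟩
    · rintro ⟨v, rfl, h⟩; exact h.symm
  rw [this, card_map, card_univ, ZMod.card]

/-- In phase `x₁k + y₁` the letter `x` has `R`-degree `k`. [folklore] -/
theorem topDeg_TRk (x y : ZMod k × ZMod k) : topDeg (TRk k) (x.1.val * k + y.1.val) x = k := by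
  classical
  have hk : 0 < k := Nat.pos_of_ne_zero (NeZero.ne k)
  have hdiv : (x.1.val * k + y.1.val) / k = x.1.val := by
    rw [Nat.add_comm, Nat.add_mul_div_right _ _ hk, Nat.div_eq_of_lt (ZMod.val_lt y.1), zero_add]
  unfold topDeg
  have : (univ.filter fun u : ZMod k × ZMod k => TRk k (x.1.val * k + y.1.val) u = x) =
      univ.filter fun u : ZMod k × ZMod k => u.2 = x.2 := by
    refine filter_congr fun u _ => ?_
    simp only [TRk, hdiv, ZMod.natCast_zmod_val, Prod.ext_iff, true_and]
  rw [this, card_filter_snd_eq]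

/-- In phase `x₁k + y₁` the letter `y` has `Q`-degree `k`. [folklore] -/
theorem topDeg_TQk (x y : ZMod k × ZMod k) : topDeg (TQk k) (x.1.val * k + y.1.val) y = k := by
  classical
  have hk : 0 < k := Nat.pos_of_ne_zero (NeZero.ne k)
  have hdiv : (x.1.val * k + y.1.val) / k = x.1.val := by
    rw [Nat.add_comm, Nat.add_mul_div_right _ _ hk, Nat.div_eq_of_lt (ZMod.val_lt y.1), zero_add]
  have hcast : (((x.1.val * k + y.1.val : ℕ)) : ZMod k) = y.1 := by
    push_cast
    rw [ZMod.natCast_zmod_val, ZMod.natCast_zmod_val, ZMod.natCast_self, mul_zero, zero_add]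
  unfold topDeg
  have : (univ.filter fun t : ZMod k × ZMod k => TQk k (x.1.val * k + y.1.val) t = y) =
      univ.filter fun t : ZMod k × ZMod k => t.2 = y.2 - x.1 := by
    refine filter_congr fun t _ => ?_
    simp only [TQk, hdiv, hcast, ZMod.natCast_zmod_val, Prod.ext_iff, true_and]
    constructor
    · intro h; rw [← h]; ring
    · intro h; rw [h]; ring
  rw [this, card_filter_snd_eq]

/-- The doubly heavy phase is `≤ k² - 1`. [folklore] -/
theorem bk_le (p : (ZMod k × ZMod k) × (ZMod k × ZMod k)) : bk k p ≤ k * k - 1 := by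
  unfold bk
  have h1 := ZMod.val_lt p.1.1
  have h2 := ZMod.val_lt p.2.1
  have hk : 0 < k := Nat.pos_of_ne_zero (NeZero.ne k)
  have : p.1.1.val * k + p.2.1.val + 1 ≤ k * k := by
    calc p.1.1.val * k + p.2.1.val + 1 ≤ p.1.1.val * k + k := by omega
      _ = (p.1.1.val + 1) * k := by ring
      _ ≤ k * k := Nat.mul_le_mul_right _ (by omega)
  omega

end SharpFamily5

open SharpFamily5 in
/-- **The combinatorial core is sharp at exponent `5/2`.**  Over `G = ZMod k × ZMod k` (`|G| = k²`) there are two INTERVAL SYSTEMS and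
times `b ≤ k² - 1` for which `Σ_{(x,y)} min (topDeg TQ (b(x,y)) y) (topDeg TR (b(x,y)) x) = k⁵ = |G|^{5/2}` — matching the exponent of
`sum_min_topDeg_le` (`≤ 2K|G|² + 16|G|³/K`).  Hence the geometric systems must be COUPLED to improve the general totals bound below
`|G|^{5/2}`. [folklore] -/
theorem sum_min_topDeg_sharp (k : ℕ) [NeZero k] :
    ∃ (TQ TR : ℕ → ZMod k × ZMod k → ZMod k × ZMod k) (b : (ZMod k × ZMod k) × (ZMod k × ZMod k) → ℕ),
      IsIntervalSys (k * k - 1) TQ ∧ IsIntervalSys (k * k - 1) TR ∧ (∀ p, b p ≤ k * k - 1) ∧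
      ∑ p, min (topDeg TQ (b p) p.2) (topDeg TR (b p) p.1) = k ^ 5 := by
  classical
  refine ⟨TQk k, TRk k, bk k, isIntervalSys_TQk, isIntervalSys_TRk, bk_le, ?_⟩
  have hterm : ∀ p : (ZMod k × ZMod k) × (ZMod k × ZMod k), min (topDeg (TQk k) (bk k p) p.2) (topDeg (TRk k) (bk k p) p.1) = k := by
    rintro ⟨x, y⟩
    simp only [bk]
    rw [topDeg_TQk x y, topDeg_TRk x y, min_self]
  simp only [hterm, sum_const, card_univ, Fintype.card_prod, ZMod.card, smul_eq_mul]
  ring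

open SharpFamily5 in
/-- The same in `|G|`-form: the sharp family has `|G| = k²` and `(Σ min)² = |G|⁵`. [folklore] -/
theorem sum_min_topDeg_sharp_card (k : ℕ) [NeZero k] :
    Fintype.card (ZMod k × ZMod k) = k ^ 2 ∧
    (∑ p : (ZMod k × ZMod k) × (ZMod k × ZMod k), min (topDeg (TQk k) (bk k p) p.2) (topDeg (TRk k) (bk k p) p.1)) ^ 2 =
      Fintype.card (ZMod k × ZMod k) ^ 5 := by
  classical
  have hterm : ∀ p : (ZMod k × ZMod k) × (ZMod k × ZMod k), min (topDeg (TQk k) (bk k p) p.2) (topDeg (TRk k) (bk k p) p.1) = k := by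
    rintro ⟨x, y⟩
    simp only [bk]
    rw [topDeg_TQk x y, topDeg_TRk x y, min_self]
  refine ⟨by rw [Fintype.card_prod, ZMod.card, sq], ?_⟩
  simp only [hterm, sum_const, card_univ, Fintype.card_prod, ZMod.card, smul_eq_mul]
  ring

end TotalsLaw

end Summit.ValiantsHypothesis.ValiantsHypothesis.Theorems.NewtonUnitEquationsDissociatedUniform
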